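import Summits.QuantumFields.YangMills.Theorems.BalabanUVNodesN19JointLawPriceCompositionsLipschitz

/-!
# YM-DAG node N19 (= NE7 proper) — COMPOSITIONS `h(Σ_i φ_i(x_i))`: the `√L` EXCESS IS CONFINED TO ROUGH∘ROUGH (a POLYNOMIAL LINK of LIPSCHITZ
# inner functions is priced LINEARLY in `d` at RATE `1∕L`), and the composition price per coordinate is MONOTONE UNDER BLOCKING

Cell `pub-ymgap`, HUMAN RULING D-0062 (Track A) ∕ D-0149 (work-bound push), R141 (C) wider-strategy seat `pub-ymgap-dag-n19-e` (strategy
s3 = ALTERNATIVE CURRENCY), generation g28, module 1 (lineage module 112).  Route `Summits/QuantumFields/YangMills/Theses/BalabanUVNodes.lean`,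
cluster item K3⁸ «SpineGivenEndpointR13SepCoPHV» (stmt-QuantumFields-27366); filed `--supports` that item `--as helper` (it proves no registered
stub).  COUNT-NEUTRAL: [folklore] bookkeeping over Mathlib and the lineage BY NAME — module 110 `…N19JointLawPriceCompositions`
(`abs_integral_statPow_sub_le`: `|∫S_p^n dP − ∫S_p^n dQ| ≤ (dΛ)^n r` for a polynomial statistic `S_p = Σ_i p_i(x_i)` of coefficient mass `≤ Λ`),
module 111 `…N19JointLawPriceCompositionsLipschitz` (`exists_jacksonPoly_near`: one-dimensional Jackson WITH coefficient mass), p568465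
`…N19JointLawBernstein` (`integrable_of_continuous_of_cube`), p584370 `…N19JointLawPriceDimension` (`abs_integral_le_of_cube`); no scheme object
used, no Theses import; NOT a discharge claim.

CONTEXT.  Under uniform mixed-moment closeness `r` (`L = log r⁻¹`) of two laws on `[−1,1]^ι` (`d = |ι|`) the joint-law price is `Θ(d²∕(d + L))`
for general ℓ¹-Lipschitz functionals (module 107), `Θ(A∕L)` for ridge functionals (module 108), `≲ d·B·log(9Λ²∕B²)∕L` for Lipschitz links of
additive POLYNOMIAL statistics (module 110), and `≲ d∕√L` for Lipschitz links of additive LIPSCHITZ statistics `h(Σ_i φ_i(x_i))` (module 111,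
one-sided; CURRENCY-MAP v6's first open item: is the truth `d∕L`, `d∕√L`, or in between?).  The `√L` of module 111 is the product of TWO
polynomial degrees: the inner Jackson degree `m₁` (error `πK_φ∕m₁` per string, paid `d` times through the `K`-Lipschitz link) and the outer
Jackson degree `m₂` (error `πK dB∕m₂`), with `m₁·m₂ ≲ L` forced by the coefficient mass `(m₁9^{m₁})^{2m₂}`.  This module records the two
structural facts that frame the open question.
§1 `abs_integral_eval_comp_stat_sub_le`: a POLYNOMIAL `q` (degree `≤ D`, coefficient mass `Λ_q`) of a normalised polynomial statistic
   `S_p∕A` with `dΛ ≤ ρA`, `1 ≤ ρ`, is paid `≤ Λ_q·ρ^D·r` (module 110 §2 summed against the coefficients of `q`).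
§2 ★★ `law_price_outerPolynomial_composition_le`: LIPSCHITZ INNER, POLYNOMIAL OUTER — `φ_i` `K_φ`-Lipschitz and `G_φ`-bounded on `[−1,1]`
   (`0 < G_φ`), the link `h(s) = q(s∕(dM))` with `M = G_φ + πK_φ`, `deg q ≤ D`, coefficient mass `Λ_q`, `h` `K`-Lipschitz on `[−dM, dM]`:
   `|∫h(Σφ_i(x_i)) dP − ∫h(Σφ_i(x_i)) dQ| ≤ 2K·d·(K_φ π∕m₁) + Λ_q·(m₁9^{m₁})^D·r` for EVERY `m₁ ≥ 1` — module 111 §1's Jackson inners, then §1;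
   there is NO outer Jackson step and hence no `m₂`.
§3 ★ `law_price_outerPolynomial_composition_le_of_small`: at `r ≤ (m₁·(m₁9^{m₁})^D)⁻¹` (i.e. `log r⁻¹ ≍ D·m₁·log(9m₁)`):
   `≤ (2πK K_φ d + Λ_q)∕m₁` — LINEAR in `d` at RATE `1∕L` (times the outer degree `D`).  This is the mirror image of module 110 (polynomial inner,
   Lipschitz outer): the extra `√L` of module 111 can only be paid when BOTH the link `h` and the inner functions `φ_i` are non-polynomial
   («rough∘rough»); every smooth-outer composition (e.g. a truncated characteristic function `cos(ω Σφ_i(x_i))` of the statistic at frequency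
   `ω ≲ √L∕(dM)`, by Taylor truncation — not typed here) is in the linear-rate class.
§4 ★ BLOCK EMBEDDING (the `k`-block generalisation of module 108's diagonal witness): `blockEmbed b a = (i ↦ a (b i))` for a block map
   `b : ι → κ`; `map_blockEmbed_carried` · `integral_map_blockEmbed` · `prod_pow_blockEmbed` (`∏_i x_i^{j_i} ∘ blockEmbed = ∏_c a_c^{Σ_{b i = c} j_i}`) ·
   ★ `moments_close_map_blockEmbed` (mixed-moment `r`-closeness on `[−1,1]^κ` transfers to the push-forwards on `[−1,1]^ι`, EVERY exponent
   vector) · `sum_comp_blockEmbed` (`Σ_i ψ_{b i}(x_i) ∘ blockEmbed = Σ_c n_c·ψ_c(a_c)`, `n_c` the fibre sizes) · ★ `integral_comp_stat_map_blockEmbed`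
   · ★★ `composition_gap_map_blockEmbed` (for CONSTANT fibre size `n`, `d = nk`: the push-forwards on `[−1,1]^ι` are carried by the cube, have
   ALL mixed moments `r`-close, and pay the link `s ↦ g(s∕n)` of the blocked statistic `Σ_i ψ_{b i}(x_i)` EXACTLY what the `κ`-pair pays the
   link `g` of `Σ_c ψ_c(a_c)`).  CONSEQUENCE (prose; the class of `K`-Lipschitz links is
   a cone): writing `E_d(K)` for the supremum of the composition price over `K`-Lipschitz links of `1`-Lipschitz inners of `d` strings,
   `E_d(K) ≥ E_k(K·d∕k) = (d∕k)·E_k(K)` whenever `k ∣ d` — the price PER COORDINATE is monotone under blocking, so «is `d∕√L` sharp?» is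
   EQUIVALENT to the growth in `k` of the FIXED-dimension constants `c_k(L) = E_k·L∕k` (ridge picture: `O(1)` uniformly; nesting picture: `≍ k`
   with onset `L ≍ k²`): the high-dimensional question lives entirely in low dimension.
READING for N19 (honest): among observables «Lipschitz profile of a sum of one-string Lipschitz observables» of `d` strings, only those whose
PROFILE AND one-string observables are both non-polynomial can converge slower than `≍ d∕log R_K⁻¹` under the uniform target; whether any does is
OPEN (numerics on `c_k` commissioned this generation).

HONEST FRAMING (binding).  Elementary and [folklore]; TOY laws; NO consumer in the DAG today (an optimality map of the seat's own currency); nothing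
of Bałaban's instantiated; NE7 NOT PRINTED, NOT proved; N19 NOT discharged; count-neutral.  One finite `T⁴` programme at fixed `ε`; nothing
continuum ∕ `ℝ⁴` ∕ OS ∕ mass-gap ∕ Clay.  0 `def` (the block map is a plain lambda inside the statements) ∕ 0 `sorry`.
-/

noncomputable section

open Real Finset MeasureTheory Polynomial

namespace Summit.QuantumFields.YangMills.Theorems.BalabanUVNodesN19JointLawPriceCompositionsOuterPolynomial

open Summit.QuantumFields.YangMills.Theorems.BalabanUVNodesN19JointLawPriceCompositions (abs_integral_statPow_sub_le abs_stat_le)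
open Summit.QuantumFields.YangMills.Theorems.BalabanUVNodesN19JointLawPriceCompositionsLipschitz (exists_jacksonPoly_near)
open Summit.QuantumFields.YangMills.Theorems.BalabanUVNodesN19JointLawPriceDimension (abs_integral_le_of_cube)
open Summit.QuantumFields.YangMills.Theorems.BalabanUVNodesN19JointLawBernstein (integrable_of_continuous_of_cube)

variable {ι : Type*} [Fintype ι] [DecidableEq ι]

/-! ## §1 A polynomial of a normalised polynomial statistic [folklore] -/

/-- **A POLYNOMIAL OF A POLYNOMIAL STATISTIC.**  `P, Q` on `[−1,1]^ι` with ALL mixed moments `r`-close (`0 ≤ r`); `p_i` of degree `≤ D'` with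
coefficient mass `Λ_{D'}(p_i) ≤ Λ`; `A > 0` and `ρ ≥ 1` with `dΛ ≤ ρA`; `q` of degree `≤ D`.  Then
`|∫q((Σ_i p_i(x_i))∕A) dP − ∫q((Σ_i p_i(x_i))∕A) dQ| ≤ (Σ_{k ≤ D}|[x^k]q|)·ρ^D·r` — module 110's `|∫S_p^k d(P − Q)| ≤ (dΛ)^k r` summed against the
coefficients of `q`. [folklore] -/
theorem abs_integral_eval_comp_stat_sub_le {P Q : Measure (ι → ℝ)} [IsProbabilityMeasure P] [IsProbabilityMeasure Q]
    (hP : P (Set.pi Set.univ (fun _ : ι => Set.Icc (-1 : ℝ) 1))ᶜ = 0) (hQ : Q (Set.pi Set.univ (fun _ : ι => Set.Icc (-1 : ℝ) 1))ᶜ = 0)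
    {r : ℝ} (hr : 0 ≤ r) (hmom : ∀ j : ι → ℕ, |∫ x, ∏ i, x i ^ j i ∂P - ∫ x, ∏ i, x i ^ j i ∂Q| ≤ r)
    (p : ι → ℝ[X]) {D' : ℕ} (hp : ∀ i, (p i).natDegree ≤ D') {Λ : ℝ} (hΛ0 : 0 ≤ Λ)
    (hΛ : ∀ i, ∑ k ∈ range (D' + 1), |(p i).coeff k| ≤ Λ) {A ρ : ℝ} (hA : 0 < A) (hρ1 : 1 ≤ ρ)
    (hρ : (Fintype.card ι : ℝ) * Λ ≤ ρ * A) (q : ℝ[X]) {D : ℕ} (hq : q.natDegree ≤ D) :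
    |∫ x, q.eval ((∑ i, (p i).eval (x i)) / A) ∂P - ∫ x, q.eval ((∑ i, (p i).eval (x i)) / A) ∂Q| ≤
      (∑ k ∈ range (D + 1), |q.coeff k|) * ρ ^ D * r := by
  classical
  set S : (ι → ℝ) → ℝ := fun x => ∑ i, (p i).eval (x i) with hS
  have hSc : Continuous S := continuous_finsetSum _ fun i _ => (Polynomial.continuous _).comp (continuous_apply i)
  -- expand `q` in monomials
  have hexp : ∀ x : ι → ℝ, q.eval (S x / A) = ∑ k ∈ range (D + 1), q.coeff k * (S x / A) ^ k := fun x =>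
    Polynomial.eval_eq_sum_range' (Nat.lt_succ_of_le hq) _
  have hint : ∀ (μ : Measure (ι → ℝ)) [IsProbabilityMeasure μ], μ (Set.pi Set.univ (fun _ : ι => Set.Icc (-1 : ℝ) 1))ᶜ = 0 →
      ∫ x, q.eval (S x / A) ∂μ = ∑ k ∈ range (D + 1), q.coeff k * ((∫ x, S x ^ k ∂μ) / A ^ k) := by
    intro μ _ hμ
    have hI : ∀ k : ℕ, Integrable (fun x => q.coeff k * (S x / A) ^ k) μ := fun k =>
      (integrable_of_continuous_of_cube hμ ((hSc.div_const A).pow k)).const_mul _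
    simp_rw [hexp]
    rw [integral_finsetSum _ fun k _ => hI k]
    refine Finset.sum_congr rfl fun k _ => ?_
    rw [integral_const_mul]
    congr 1
    simp_rw [div_pow]
    rw [integral_div]
  rw [hint P hP, hint Q hQ, ← Finset.sum_sub_distrib]
  have hρ0 : 0 ≤ ρ := zero_le_one.trans hρ1
  have hdΛA : (Fintype.card ι : ℝ) * Λ / A ≤ ρ := by rw [div_le_iff₀ hA]; exact hρ
  have hdΛ0 : 0 ≤ (Fintype.card ι : ℝ) * Λ / A := div_nonneg (mul_nonneg (Nat.cast_nonneg _) hΛ0) hA.le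
  calc |∑ k ∈ range (D + 1), (q.coeff k * ((∫ x, S x ^ k ∂P) / A ^ k) - q.coeff k * ((∫ x, S x ^ k ∂Q) / A ^ k))|
      ≤ ∑ k ∈ range (D + 1), |q.coeff k * ((∫ x, S x ^ k ∂P) / A ^ k) - q.coeff k * ((∫ x, S x ^ k ∂Q) / A ^ k)| :=
        abs_sum_le_sum_abs _ _
    _ ≤ ∑ k ∈ range (D + 1), |q.coeff k| * (ρ ^ D * r) := Finset.sum_le_sum fun k hk => by
        have hkD : k ≤ D := Nat.lt_succ_iff.1 (Finset.mem_range.1 hk)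
        rw [← mul_sub, ← sub_div, abs_mul, abs_div, abs_of_pos (pow_pos hA k)]
        refine mul_le_mul_of_nonneg_left ?_ (abs_nonneg _)
        rw [div_le_iff₀ (pow_pos hA k)]
        calc |∫ x, S x ^ k ∂P - ∫ x, S x ^ k ∂Q| ≤ ((Fintype.card ι : ℝ) * Λ) ^ k * r :=
              abs_integral_statPow_sub_le hP hQ hr hmom p hp hΛ k
          _ = ((Fintype.card ι : ℝ) * Λ / A) ^ k * r * A ^ k := by
              rw [div_pow]; field_simp
          _ ≤ ρ ^ k * r * A ^ k :=
              mul_le_mul_of_nonneg_right (mul_le_mul_of_nonneg_right (pow_le_pow_left₀ hdΛ0 hdΛA k) hr) (pow_pos hA k).le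
          _ ≤ ρ ^ D * r * A ^ k :=
              mul_le_mul_of_nonneg_right (mul_le_mul_of_nonneg_right (pow_le_pow_right₀ hρ1 hkD) hr) (pow_pos hA k).le
    _ = (∑ k ∈ range (D + 1), |q.coeff k|) * ρ ^ D * r := by rw [← Finset.sum_mul]; ring

/-! ## §2 ★★ Lipschitz inner, polynomial outer: linear in `d` with no second Jackson degree [folklore] -/

/-- ★★ **LIPSCHITZ INNER, POLYNOMIAL OUTER: `2K·d·(K_φπ∕m₁) + Λ_q·(m₁9^{m₁})^D·r`.**  `P, Q` on `[−1,1]^ι` with all mixed moments `r`-close (`0 ≤ r`);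
`φ_i` continuous, `K_φ`-Lipschitz and `G_φ`-bounded on `[−1,1]` (`0 ≤ K_φ`, `0 < G_φ`); `M = G_φ + πK_φ`; the link is the polynomial
`h(s) = q(s∕(dM))` with `deg q ≤ D`, coefficient mass `Σ_{k≤D}|[x^k]q| ≤ Λ_q`, and `h` is `K`-Lipschitz on `[−dM, dM]` (`0 ≤ K`).  Then for every
`m₁ ≥ 1`: `|∫h(Σφ_i(x_i)) dP − ∫h(Σφ_i(x_i)) dQ| ≤ 2·(K·(d·(K_φ(π∕m₁)))) + Λ_q·(m₁9^{m₁})^D·r` — each `φ_i` replaced by its Jackson polynomial of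
module 111 §1 (degree `2m₁`, error `πK_φ∕m₁`, mass `≤ G_φ m₁9^{m₁} ≤ M·m₁9^{m₁}`), then §1 with `ρ = m₁9^{m₁}`.  No outer Jackson step. [folklore] -/
theorem law_price_outerPolynomial_composition_le [Nonempty ι] {P Q : Measure (ι → ℝ)} [IsProbabilityMeasure P] [IsProbabilityMeasure Q]
    (hP : P (Set.pi Set.univ (fun _ : ι => Set.Icc (-1 : ℝ) 1))ᶜ = 0) (hQ : Q (Set.pi Set.univ (fun _ : ι => Set.Icc (-1 : ℝ) 1))ᶜ = 0)
    {r : ℝ} (hr : 0 ≤ r) (hmom : ∀ j : ι → ℕ, |∫ x, ∏ i, x i ^ j i ∂P - ∫ x, ∏ i, x i ^ j i ∂Q| ≤ r)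
    {φ : ι → ℝ → ℝ} (hφc : ∀ i, Continuous (φ i)) {Kφ Gφ : ℝ} (hKφ0 : 0 ≤ Kφ) (hGφ0 : 0 < Gφ)
    (hφK : ∀ (i : ι) (x y : ℝ), x ∈ Set.Icc (-1 : ℝ) 1 → y ∈ Set.Icc (-1 : ℝ) 1 → |φ i x - φ i y| ≤ Kφ * |x - y|)
    (hφG : ∀ (i : ι) (x : ℝ), x ∈ Set.Icc (-1 : ℝ) 1 → |φ i x| ≤ Gφ)
    (q : ℝ[X]) {D : ℕ} (hq : q.natDegree ≤ D) {Λq : ℝ} (hΛq : ∑ k ∈ range (D + 1), |q.coeff k| ≤ Λq) {K : ℝ} (hK0 : 0 ≤ K)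
    (hK : ∀ s s' : ℝ, s ∈ Set.Icc (-(Fintype.card ι * (Gφ + π * Kφ))) (Fintype.card ι * (Gφ + π * Kφ)) →
      s' ∈ Set.Icc (-(Fintype.card ι * (Gφ + π * Kφ))) (Fintype.card ι * (Gφ + π * Kφ)) →
      |q.eval (s / (Fintype.card ι * (Gφ + π * Kφ))) - q.eval (s' / (Fintype.card ι * (Gφ + π * Kφ)))| ≤ K * |s - s'|)
    {m₁ : ℕ} (hm₁ : 0 < m₁) :
    |∫ x, q.eval ((∑ i, φ i (x i)) / (Fintype.card ι * (Gφ + π * Kφ))) ∂P -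
        ∫ x, q.eval ((∑ i, φ i (x i)) / (Fintype.card ι * (Gφ + π * Kφ))) ∂Q| ≤
      2 * (K * (Fintype.card ι * (Kφ * (π / m₁)))) + Λq * ((m₁ : ℝ) * 9 ^ m₁) ^ D * r := by
  classical
  set d : ℕ := Fintype.card ι with hd
  have hdpos : (0 : ℝ) < d := by exact_mod_cast (Fintype.card_pos : 0 < d)
  set M : ℝ := Gφ + π * Kφ with hM
  have hM0 : 0 < M := by rw [hM]; nlinarith [Real.pi_pos]
  set A : ℝ := d * M with hA
  have hA0 : 0 < A := mul_pos hdpos hM0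
  have hm₁r : (0 : ℝ) < m₁ := by exact_mod_cast hm₁
  have hπm : 0 ≤ Kφ * (π / m₁) := mul_nonneg hKφ0 (div_nonneg Real.pi_pos.le hm₁r.le)
  -- the Jackson polynomials of the inner functions (module 111 §1)
  have hex : ∀ i, ∃ p : ℝ[X], p.natDegree ≤ 2 * m₁ ∧ (∀ x : ℝ, x ∈ Set.Icc (-1 : ℝ) 1 → |φ i x - p.eval x| ≤ Kφ * (π / m₁)) ∧
      (∀ e : ℕ, ∑ k ∈ range (e + 1), |p.coeff k| ≤ Gφ * (m₁ * 9 ^ m₁)) ∧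
      ∀ x : ℝ, x ∈ Set.Icc (-1 : ℝ) 1 → |p.eval x| ≤ Gφ + Kφ * (π / m₁) := fun i =>
    exists_jacksonPoly_near hKφ0 (hφK i) (hφG i) hm₁
  choose p hpdeg hperr hpmass hpB using hex
  -- §1 on the polynomial statistic with `ρ = m₁·9^{m₁}`
  set ρ : ℝ := m₁ * 9 ^ m₁ with hρ
  have h9 : (1 : ℝ) ≤ 9 ^ m₁ := one_le_pow₀ (by norm_num)
  have hm1 : (1 : ℝ) ≤ m₁ := by exact_mod_cast hm₁
  have hρ1 : 1 ≤ ρ := by rw [hρ]; nlinarith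
  have hGM : Gφ ≤ M := by rw [hM]; nlinarith [Real.pi_pos]
  have hρA : (d : ℝ) * (Gφ * (m₁ * 9 ^ m₁)) ≤ ρ * A := by
    rw [hρ, hA]
    have : Gφ * (m₁ * 9 ^ m₁) ≤ M * (m₁ * 9 ^ m₁) := mul_le_mul_of_nonneg_right hGM (by positivity)
    nlinarith [mul_le_mul_of_nonneg_left this hdpos.le]
  have hpoly := abs_integral_eval_comp_stat_sub_le hP hQ hr hmom p hpdeg (by positivity : (0 : ℝ) ≤ Gφ * (m₁ * 9 ^ m₁))
    (fun i => hpmass i (2 * m₁)) hA0 hρ1 hρA q hq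
  -- the inner approximation, law by law
  have hsumφ : ∀ u : ι → ℝ, (∀ i, u i ∈ Set.Icc (-1 : ℝ) 1) → ∑ i, φ i (u i) ∈ Set.Icc (-((d : ℝ) * M)) (d * M) := by
    intro u hu
    have hb : |∑ i, φ i (u i)| ≤ d * M := by
      calc |∑ i, φ i (u i)| ≤ ∑ i, |φ i (u i)| := abs_sum_le_sum_abs _ _
        _ ≤ ∑ _i : ι, M := Finset.sum_le_sum fun i _ => (hφG i _ (hu i)).trans hGM
        _ = d * M := by rw [Finset.sum_const, Finset.card_univ, nsmul_eq_mul]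
    exact ⟨(abs_le.1 hb).1, (abs_le.1 hb).2⟩
  have hB₁M : Gφ + Kφ * (π / m₁) ≤ M := by
    rw [hM]
    have : π / m₁ ≤ π := div_le_self Real.pi_pos.le hm1
    nlinarith
  have hsump : ∀ u : ι → ℝ, (∀ i, u i ∈ Set.Icc (-1 : ℝ) 1) → ∑ i, (p i).eval (u i) ∈ Set.Icc (-((d : ℝ) * M)) (d * M) := by
    intro u hu
    have hb : |∑ i, (p i).eval (u i)| ≤ d * M := by
      calc |∑ i, (p i).eval (u i)| ≤ ∑ i, |(p i).eval (u i)| := abs_sum_le_sum_abs _ _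
        _ ≤ ∑ _i : ι, M := Finset.sum_le_sum fun i _ => (hpB i _ (hu i)).trans hB₁M
        _ = d * M := by rw [Finset.sum_const, Finset.card_univ, nsmul_eq_mul]
    exact ⟨(abs_le.1 hb).1, (abs_le.1 hb).2⟩
  have hptw : ∀ u : ι → ℝ, (∀ i, u i ∈ Set.Icc (-1 : ℝ) 1) →
      |q.eval ((∑ i, φ i (u i)) / A) - q.eval ((∑ i, (p i).eval (u i)) / A)| ≤ K * (d * (Kφ * (π / m₁))) := by
    intro u hu
    calc |q.eval ((∑ i, φ i (u i)) / A) - q.eval ((∑ i, (p i).eval (u i)) / A)|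
        ≤ K * |∑ i, φ i (u i) - ∑ i, (p i).eval (u i)| := hK _ _ (hsumφ u hu) (hsump u hu)
      _ ≤ K * (d * (Kφ * (π / m₁))) := mul_le_mul_of_nonneg_left (by
          rw [← Finset.sum_sub_distrib]
          calc |∑ i, (φ i (u i) - (p i).eval (u i))| ≤ ∑ i, |φ i (u i) - (p i).eval (u i)| := abs_sum_le_sum_abs _ _
            _ ≤ ∑ _i : ι, Kφ * (π / m₁) := Finset.sum_le_sum fun i _ => hperr i _ (hu i)
            _ = d * (Kφ * (π / m₁)) := by rw [Finset.sum_const, Finset.card_univ, nsmul_eq_mul]) hK0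
  have hcφ : Continuous fun x : ι → ℝ => q.eval ((∑ i, φ i (x i)) / A) :=
    (Polynomial.continuous q).comp ((continuous_finsetSum _ fun i _ => (hφc i).comp (continuous_apply i)).div_const _)
  have hcp : Continuous fun x : ι → ℝ => q.eval ((∑ i, (p i).eval (x i)) / A) :=
    (Polynomial.continuous q).comp
      ((continuous_finsetSum _ fun i _ => (Polynomial.continuous _).comp (continuous_apply i)).div_const _)
  have happrox : ∀ (μ : Measure (ι → ℝ)) [IsProbabilityMeasure μ], μ (Set.pi Set.univ (fun _ : ι => Set.Icc (-1 : ℝ) 1))ᶜ = 0 →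
      |∫ x, q.eval ((∑ i, φ i (x i)) / A) ∂μ - ∫ x, q.eval ((∑ i, (p i).eval (x i)) / A) ∂μ| ≤ K * (d * (Kφ * (π / m₁))) := by
    intro μ _ hμ
    rw [← integral_sub (integrable_of_continuous_of_cube hμ hcφ) (integrable_of_continuous_of_cube hμ hcp)]
    exact abs_integral_le_of_cube hμ hptw
  have hPa := happrox P hP
  have hQa := happrox Q hQ
  -- the polynomial road: `Λ_q ρ^D r`
  have hρD : (∑ k ∈ range (D + 1), |q.coeff k|) * ρ ^ D * r ≤ Λq * ρ ^ D * r :=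
    mul_le_mul_of_nonneg_right (mul_le_mul_of_nonneg_right hΛq (pow_nonneg (zero_le_one.trans hρ1) _)) hr
  have key : |∫ x, q.eval ((∑ i, φ i (x i)) / A) ∂P - ∫ x, q.eval ((∑ i, φ i (x i)) / A) ∂Q| ≤
      |∫ x, q.eval ((∑ i, φ i (x i)) / A) ∂P - ∫ x, q.eval ((∑ i, (p i).eval (x i)) / A) ∂P| +
        |∫ x, q.eval ((∑ i, (p i).eval (x i)) / A) ∂P - ∫ x, q.eval ((∑ i, (p i).eval (x i)) / A) ∂Q| +
        |∫ x, q.eval ((∑ i, φ i (x i)) / A) ∂Q - ∫ x, q.eval ((∑ i, (p i).eval (x i)) / A) ∂Q| := by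
    have e : ∫ x, q.eval ((∑ i, φ i (x i)) / A) ∂P - ∫ x, q.eval ((∑ i, φ i (x i)) / A) ∂Q =
        (∫ x, q.eval ((∑ i, φ i (x i)) / A) ∂P - ∫ x, q.eval ((∑ i, (p i).eval (x i)) / A) ∂P) +
          (∫ x, q.eval ((∑ i, (p i).eval (x i)) / A) ∂P - ∫ x, q.eval ((∑ i, (p i).eval (x i)) / A) ∂Q) -
          (∫ x, q.eval ((∑ i, φ i (x i)) / A) ∂Q - ∫ x, q.eval ((∑ i, (p i).eval (x i)) / A) ∂Q) := by ring
    rw [e]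
    exact (abs_sub _ _).trans (add_le_add (abs_add_le _ _) le_rfl)
  calc |∫ x, q.eval ((∑ i, φ i (x i)) / A) ∂P - ∫ x, q.eval ((∑ i, φ i (x i)) / A) ∂Q|
      ≤ K * (d * (Kφ * (π / m₁))) + (∑ k ∈ range (D + 1), |q.coeff k|) * ρ ^ D * r + K * (d * (Kφ * (π / m₁))) :=
        key.trans (add_le_add (add_le_add hPa hpoly) hQa)
    _ ≤ K * (d * (Kφ * (π / m₁))) + Λq * ρ ^ D * r + K * (d * (Kφ * (π / m₁))) := by linarith
    _ = 2 * (K * (d * (Kφ * (π / m₁)))) + Λq * ρ ^ D * r := by ring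

/-! ## §3 ★ The optimised form: rate `1∕L`, linear in `d` [folklore] -/

/-- ★ **RATE `1∕L`, LINEAR IN `d`.**  In the setting of `law_price_outerPolynomial_composition_le`, if moreover `r ≤ (m₁·(m₁9^{m₁})^D)⁻¹` (that is,
`log r⁻¹ ≍ D·m₁·log(9m₁)`) then `|∫h(Σφ_i(x_i)) dP − ∫h(Σφ_i(x_i)) dQ| ≤ (2πK K_φ d + Λ_q)∕m₁`: a POLYNOMIAL link of LIPSCHITZ one-string
observables is in the linear-rate class, like a Lipschitz link of polynomial observables (module 110); the `√L` of module 111 needs BOTH rough.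
[folklore] -/
theorem law_price_outerPolynomial_composition_le_of_small [Nonempty ι] {P Q : Measure (ι → ℝ)} [IsProbabilityMeasure P]
    [IsProbabilityMeasure Q]
    (hP : P (Set.pi Set.univ (fun _ : ι => Set.Icc (-1 : ℝ) 1))ᶜ = 0) (hQ : Q (Set.pi Set.univ (fun _ : ι => Set.Icc (-1 : ℝ) 1))ᶜ = 0)
    {r : ℝ} (hr : 0 ≤ r) (hmom : ∀ j : ι → ℕ, |∫ x, ∏ i, x i ^ j i ∂P - ∫ x, ∏ i, x i ^ j i ∂Q| ≤ r)
    {φ : ι → ℝ → ℝ} (hφc : ∀ i, Continuous (φ i)) {Kφ Gφ : ℝ} (hKφ0 : 0 ≤ Kφ) (hGφ0 : 0 < Gφ)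
    (hφK : ∀ (i : ι) (x y : ℝ), x ∈ Set.Icc (-1 : ℝ) 1 → y ∈ Set.Icc (-1 : ℝ) 1 → |φ i x - φ i y| ≤ Kφ * |x - y|)
    (hφG : ∀ (i : ι) (x : ℝ), x ∈ Set.Icc (-1 : ℝ) 1 → |φ i x| ≤ Gφ)
    (q : ℝ[X]) {D : ℕ} (hq : q.natDegree ≤ D) {Λq : ℝ} (hΛq : ∑ k ∈ range (D + 1), |q.coeff k| ≤ Λq) {K : ℝ} (hK0 : 0 ≤ K)
    (hK : ∀ s s' : ℝ, s ∈ Set.Icc (-(Fintype.card ι * (Gφ + π * Kφ))) (Fintype.card ι * (Gφ + π * Kφ)) →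
      s' ∈ Set.Icc (-(Fintype.card ι * (Gφ + π * Kφ))) (Fintype.card ι * (Gφ + π * Kφ)) →
      |q.eval (s / (Fintype.card ι * (Gφ + π * Kφ))) - q.eval (s' / (Fintype.card ι * (Gφ + π * Kφ)))| ≤ K * |s - s'|)
    {m₁ : ℕ} (hm₁ : 0 < m₁) (hsmall : r ≤ 1 / ((m₁ : ℝ) * ((m₁ : ℝ) * 9 ^ m₁) ^ D)) :
    |∫ x, q.eval ((∑ i, φ i (x i)) / (Fintype.card ι * (Gφ + π * Kφ))) ∂P -
        ∫ x, q.eval ((∑ i, φ i (x i)) / (Fintype.card ι * (Gφ + π * Kφ))) ∂Q| ≤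
      (2 * π * K * Kφ * Fintype.card ι + Λq) / m₁ := by
  have h1 := law_price_outerPolynomial_composition_le hP hQ hr hmom hφc hKφ0 hGφ0 hφK hφG q hq hΛq hK0 hK hm₁
  have hm₁r : (0 : ℝ) < m₁ := by exact_mod_cast hm₁
  have hΛq0 : 0 ≤ Λq := (Finset.sum_nonneg fun _ _ => abs_nonneg _).trans hΛq
  have hρpos : (0 : ℝ) < ((m₁ : ℝ) * 9 ^ m₁) ^ D := by positivity
  have hterm : Λq * ((m₁ : ℝ) * 9 ^ m₁) ^ D * r ≤ Λq / m₁ := by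
    have hx : ((m₁ : ℝ) * 9 ^ m₁) ^ D * r ≤ 1 / m₁ := by
      calc ((m₁ : ℝ) * 9 ^ m₁) ^ D * r ≤ ((m₁ : ℝ) * 9 ^ m₁) ^ D * (1 / ((m₁ : ℝ) * ((m₁ : ℝ) * 9 ^ m₁) ^ D)) :=
            mul_le_mul_of_nonneg_left hsmall hρpos.le
        _ = 1 / m₁ := by field_simp
    calc Λq * ((m₁ : ℝ) * 9 ^ m₁) ^ D * r = Λq * (((m₁ : ℝ) * 9 ^ m₁) ^ D * r) := by ring
      _ ≤ Λq * (1 / m₁) := mul_le_mul_of_nonneg_left hx hΛq0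
      _ = Λq / m₁ := mul_one_div _ _
  calc |∫ x, q.eval ((∑ i, φ i (x i)) / (Fintype.card ι * (Gφ + π * Kφ))) ∂P -
          ∫ x, q.eval ((∑ i, φ i (x i)) / (Fintype.card ι * (Gφ + π * Kφ))) ∂Q|
      ≤ 2 * (K * (Fintype.card ι * (Kφ * (π / m₁)))) + Λq * ((m₁ : ℝ) * 9 ^ m₁) ^ D * r := h1
    _ ≤ 2 * (K * (Fintype.card ι * (Kφ * (π / m₁)))) + Λq / m₁ := by linarith
    _ = (2 * π * K * Kφ * Fintype.card ι + Λq) / m₁ := by field_simp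

/-! ## §4 ★ Block embedding: the composition price per coordinate is monotone under blocking [folklore] -/

variable {κ : Type*} [Fintype κ] [DecidableEq κ]

omit [Fintype ι] [DecidableEq ι] [Fintype κ] [DecidableEq κ] in
/-- The block map `a ↦ (i ↦ a (b i))` is continuous. [bookkeeping] -/
theorem continuous_blockEmbed (b : ι → κ) : Continuous fun (a : κ → ℝ) (i : ι) => a (b i) :=
  continuous_pi fun i => continuous_apply (b i)

omit [DecidableEq ι] [DecidableEq κ] in
/-- A law carried by `[−1,1]^κ` pushes forward under the block map to a law carried by `[−1,1]^ι`. [bookkeeping] -/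
theorem map_blockEmbed_carried (b : ι → κ) {P : Measure (κ → ℝ)}
    (hP : P (Set.pi Set.univ (fun _ : κ => Set.Icc (-1 : ℝ) 1))ᶜ = 0) :
    (P.map fun (a : κ → ℝ) (i : ι) => a (b i)) (Set.pi Set.univ (fun _ : ι => Set.Icc (-1 : ℝ) 1))ᶜ = 0 := by
  rw [Measure.map_apply (continuous_blockEmbed b).measurable (MeasurableSet.univ_pi fun _ => measurableSet_Icc).compl]
  refine measure_mono_null (fun a ha => ?_) hP
  intro hacube
  apply ha
  exact Set.mem_univ_pi.2 fun i => Set.mem_univ_pi.1 hacube (b i)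

omit [DecidableEq ι] [DecidableEq κ] in
/-- Integration against the push-forward under the block map. [bookkeeping] -/
theorem integral_map_blockEmbed (b : ι → κ) (P : Measure (κ → ℝ)) {F : (ι → ℝ) → ℝ} (hF : Continuous F) :
    ∫ x, F x ∂(P.map fun (a : κ → ℝ) (i : ι) => a (b i)) = ∫ a, F (fun i => a (b i)) ∂P :=
  integral_map (continuous_blockEmbed b).measurable.aemeasurable hF.aestronglyMeasurable

omit [DecidableEq ι] in
/-- A mixed monomial of the blocked variables is a mixed monomial of the block variables: `∏_i a_{b i}^{j_i} = ∏_c a_c^{Σ_{i : b i = c} j_i}`.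
[bookkeeping] -/
theorem prod_pow_blockEmbed (b : ι → κ) (a : κ → ℝ) (j : ι → ℕ) :
    ∏ i, a (b i) ^ j i = ∏ c, a c ^ (∑ i ∈ Finset.univ.filter (fun i => b i = c), j i) := by
  rw [← Finset.prod_fiberwise Finset.univ b (fun i => a (b i) ^ j i)]
  refine Finset.prod_congr rfl fun c _ => ?_
  have h1 : ∀ i ∈ Finset.univ.filter (fun i => b i = c), a (b i) ^ j i = a c ^ j i :=
    fun i hi => by rw [(Finset.mem_filter.1 hi).2]
  rw [Finset.prod_congr rfl h1, Finset.prod_pow_eq_pow_sum]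

omit [DecidableEq ι] in
/-- ★ **MIXED-MOMENT CLOSENESS TRANSFERS UNDER BLOCKING.**  If `P, Q` on `ℝ^κ` carried by the cube have ALL mixed moments `r`-close, so do their
push-forwards under the block map `a ↦ (a_{b i})_i` on `ℝ^ι` — every exponent vector `j : ι → ℕ` is read as the exponent vector
`c ↦ Σ_{b i = c} j_i` on `κ`. [folklore] -/
theorem moments_close_map_blockEmbed (b : ι → κ) {P Q : Measure (κ → ℝ)}
    {r : ℝ} (hmom : ∀ j : κ → ℕ, |∫ a, ∏ c, a c ^ j c ∂P - ∫ a, ∏ c, a c ^ j c ∂Q| ≤ r) (j : ι → ℕ) :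
    |∫ x, ∏ i, x i ^ j i ∂(P.map fun (a : κ → ℝ) (i : ι) => a (b i)) -
        ∫ x, ∏ i, x i ^ j i ∂(Q.map fun (a : κ → ℝ) (i : ι) => a (b i))| ≤ r := by
  have hc : Continuous fun x : ι → ℝ => ∏ i, x i ^ j i := continuous_finsetProd _ fun i _ => (continuous_apply i).pow _
  rw [integral_map_blockEmbed b P hc, integral_map_blockEmbed b Q hc]
  simp only [prod_pow_blockEmbed b]
  exact hmom _

omit [DecidableEq ι] in
/-- The additive statistic of the blocked variables is a weighted additive statistic of the block variables:
`Σ_i ψ_{b i}(a_{b i}) = Σ_c n_c·ψ_c(a_c)`, `n_c = #{i : b i = c}`. [bookkeeping] -/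
theorem sum_comp_blockEmbed (b : ι → κ) (ψ : κ → ℝ → ℝ) (a : κ → ℝ) :
    ∑ i, ψ (b i) (a (b i)) = ∑ c, ((Finset.univ.filter fun i => b i = c).card : ℝ) * ψ c (a c) := by
  rw [← Finset.sum_fiberwise Finset.univ b (fun i => ψ (b i) (a (b i)))]
  refine Finset.sum_congr rfl fun c _ => ?_
  have h1 : ∀ i ∈ Finset.univ.filter (fun i => b i = c), ψ (b i) (a (b i)) = ψ c (a c) :=
    fun i hi => by rw [(Finset.mem_filter.1 hi).2]
  rw [Finset.sum_congr rfl h1, Finset.sum_const, nsmul_eq_mul]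

omit [DecidableEq ι] in
/-- ★ **A LINK OF THE BLOCKED STATISTIC INTEGRATES AS A LINK OF THE WEIGHTED BLOCK STATISTIC.**  For continuous `g` and `ψ_c`:
`∫ g(Σ_i ψ_{b i}(x_i)) d(P∘blockEmbed⁻¹) = ∫ g(Σ_c n_c ψ_c(a_c)) dP`. [folklore] -/
theorem integral_comp_stat_map_blockEmbed (b : ι → κ) (P : Measure (κ → ℝ)) {ψ : κ → ℝ → ℝ} (hψ : ∀ c, Continuous (ψ c))
    {g : ℝ → ℝ} (hg : Continuous g) :
    ∫ x, g (∑ i, ψ (b i) (x i)) ∂(P.map fun (a : κ → ℝ) (i : ι) => a (b i)) =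
      ∫ a, g (∑ c, ((Finset.univ.filter fun i => b i = c).card : ℝ) * ψ c (a c)) ∂P := by
  have hc : Continuous fun x : ι → ℝ => g (∑ i, ψ (b i) (x i)) :=
    hg.comp (continuous_finsetSum _ fun i _ => (hψ (b i)).comp (continuous_apply i))
  rw [integral_map_blockEmbed b P hc]
  refine integral_congr_ae (Filter.Eventually.of_forall fun a => ?_)
  simp only [sum_comp_blockEmbed b ψ a]

omit [DecidableEq ι] in
/-- ★★ **THE COMPOSITION GAP IS PRESERVED UNDER EQUAL BLOCKING.**  Let `b : ι → κ` have all fibres of size `n ≥ 1` (`d = n·k`).  If `P, Q` on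
`[−1,1]^κ` have all mixed moments `r`-close and the link `g` of the additive statistic `Σ_c ψ_c(a_c)` is paid `δ`, then the push-forwards on
`[−1,1]^ι` are carried by the cube, have all mixed moments `r`-close, and pay the link `s ↦ g(s∕n)` of the additive statistic `Σ_i ψ_{b i}(x_i)`
EXACTLY `δ` as well.  Since `s ↦ g(s∕n)` is `(K∕n)`-Lipschitz when `g` is `K`-Lipschitz and the class of links is a cone, the supremum `E_d(K)` of
the composition price over `K`-Lipschitz links of `d = nk` strings satisfies `E_d(K) ≥ E_k(nK) = n·E_k(K)`: the price PER STRING is monotone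
under blocking, and «is module 111's `d∕√L` sharp?» reduces to the growth in `k` of the fixed-dimension constants `E_k·L∕k`. [folklore] -/
theorem composition_gap_map_blockEmbed (b : ι → κ) {n : ℕ} (hn : 0 < n)
    (hb : ∀ c : κ, (Finset.univ.filter fun i => b i = c).card = n) {P Q : Measure (κ → ℝ)}
    (hP : P (Set.pi Set.univ (fun _ : κ => Set.Icc (-1 : ℝ) 1))ᶜ = 0) (hQ : Q (Set.pi Set.univ (fun _ : κ => Set.Icc (-1 : ℝ) 1))ᶜ = 0)
    {r : ℝ} (hmom : ∀ j : κ → ℕ, |∫ a, ∏ c, a c ^ j c ∂P - ∫ a, ∏ c, a c ^ j c ∂Q| ≤ r)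
    {ψ : κ → ℝ → ℝ} (hψ : ∀ c, Continuous (ψ c)) {g : ℝ → ℝ} (hg : Continuous g) :
    (P.map fun (a : κ → ℝ) (i : ι) => a (b i)) (Set.pi Set.univ (fun _ : ι => Set.Icc (-1 : ℝ) 1))ᶜ = 0 ∧
    (Q.map fun (a : κ → ℝ) (i : ι) => a (b i)) (Set.pi Set.univ (fun _ : ι => Set.Icc (-1 : ℝ) 1))ᶜ = 0 ∧
    (∀ j : ι → ℕ, |∫ x, ∏ i, x i ^ j i ∂(P.map fun (a : κ → ℝ) (i : ι) => a (b i)) -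
        ∫ x, ∏ i, x i ^ j i ∂(Q.map fun (a : κ → ℝ) (i : ι) => a (b i))| ≤ r) ∧
    (∫ x, g ((∑ i, ψ (b i) (x i)) / n) ∂(P.map fun (a : κ → ℝ) (i : ι) => a (b i)) -
        ∫ x, g ((∑ i, ψ (b i) (x i)) / n) ∂(Q.map fun (a : κ → ℝ) (i : ι) => a (b i)) =
      ∫ a, g (∑ c, ψ c (a c)) ∂P - ∫ a, g (∑ c, ψ c (a c)) ∂Q) := by
  have hnr : (n : ℝ) ≠ 0 := by exact_mod_cast hn.ne'
  have hg' : Continuous fun s : ℝ => g (s / n) := hg.comp (continuous_id.div_const _)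
  have hred : ∀ (μ : Measure (κ → ℝ)), ∫ x, g ((∑ i, ψ (b i) (x i)) / n) ∂(μ.map fun (a : κ → ℝ) (i : ι) => a (b i)) =
      ∫ a, g (∑ c, ψ c (a c)) ∂μ := by
    intro μ
    rw [integral_comp_stat_map_blockEmbed b μ hψ hg']
    refine integral_congr_ae (Filter.Eventually.of_forall fun a => ?_)
    simp only [hb, ← Finset.mul_sum, mul_div_cancel_left₀ _ hnr]
  exact ⟨map_blockEmbed_carried b hP, map_blockEmbed_carried b hQ, moments_close_map_blockEmbed b hmom,
    by rw [hred P, hred Q]⟩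

end Summit.QuantumFields.YangMills.Theorems.BalabanUVNodesN19JointLawPriceCompositionsOuterPolynomial

end
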